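import Mathlib
import HarnessLib

/-!
# Crux `NoZenoR` (stmt-ResolutionOfSingularities-19943), slot 5 `stub_L1wCoreF`, (B1) UP-5 — part 1/3:
# one chart of a point blow-up, read modulo `𝔪` (algebra)

OURS (cell res-hironaka, crux chain W4.4, seat res-L0-w44-stub-1 g11; object UP-5a/b of the (B1) split core of
slot 5 `stub_L1wCoreF`, res-L0-w44-stub-2 L1W-PREP §3.3 / lead B1-CENSUS-g8). Nothing here is a statement of the
manuscript under review (Hironaka 2017); AI-written, weaker than expert review. Def-free, fact-free.

Towards the `h⁰`-NUMERICS OF THE EXCEPTIONAL CURVE OF A POINT BLOW-UP (Lipman 1969 §13/§15: the exceptional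
line `F` of the blow-up of a regular point `x` of a surface has `h⁰(F) = [κ(x) : κ]` and is "of the first kind",
`h⁰(𝒪_{2F}) = 3 h⁰(F)`, i.e. `(F·F) = −h⁰(F)`), computed on the two regular-pair charts `A[v/u]`, `A[u/v]` of
the blow-up of `𝔪 = (u, v)`. This file: the algebra of ONE chart `Γ` with `Γ/𝔪Γ ≅ (A/𝔪)[X]` (`T ↦ X`):

* `eq_C_of_X_pow_mul_eq_reflect`, `eq_linear_of_X_pow_mul_eq_X_mul_reflect` — the coefficient lemmas behind
  "`Γ(ℙ¹, 𝒪) = κ`" and "`Γ(ℙ¹, 𝒪(1)) = κ ⊕ κT`": `Xᵈ p = q^refl` forces constants, `Xᵈ p = X q^refl` forces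
  degree `≤ 1` with swapped coefficients;
* `chartε_mk_aeval`, `aeval_mem_map_iff`, `algebraMap_mem_map_iff` — reading `P(T)` modulo `𝔪Γ` as `P̄`;
* `mem_span_pow_of_T_pow_mul_mem` — `Tᵉ c ∈ (wⁿ) ⇒ c ∈ (wⁿ)` when `𝔪Γ = (w)` (`T̄ = X` is a nonzerodivisor);
* `mul_linear_mem_span_sq_iff` — `w(α + βT) ∈ (w²) ⟺ α, β ∈ 𝔪`.

References: J. Lipman, Publ. Math. IHÉS 36 (1969), §13 Prop. (13.1), §15 p. 229 [`Lipman1969`];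
The Stacks Project, Tags 0804, 0BIQ [`StacksProject`].
-/

noncomputable section

-- single-problem summit: the doubled namespace component `ResolutionOfSingularities` is forced
set_option linter.dupNamespace false

namespace Summit.ResolutionOfSingularities.ResolutionOfSingularities.Theorems.NoZeno.ExcCount.PointBlowup

open Polynomial

/-! ## §1 Two coefficient lemmas -/

section Poly

variable {κ : Type*} [CommRing κ]

/-- If `X ^ d * p = reflect d q` with `natDegree q ≤ d`, then `p` and `q` are the same constant.
[this work] -/
theorem eq_C_of_X_pow_mul_eq_reflect {p q : κ[X]} {d : ℕ} (hq : q.natDegree ≤ d)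
    (h : X ^ d * p = reflect d q) :
    p = C (p.coeff 0) ∧ q = C (p.coeff 0) := by
  have hp : ∀ i, p.coeff i = q.coeff (revAt d (i + d)) := fun i => by
    rw [← coeff_X_pow_mul p d i, h, coeff_reflect]
  have hp0 : p.coeff 0 = q.coeff 0 := by
    rw [hp 0, zero_add, revAt_le le_rfl, Nat.sub_self]
  have hpi : ∀ i, 1 ≤ i → p.coeff i = 0 := fun i hi => by
    rw [hp i]
    have hlt : d < i + d := by omega
    have : revAt d (i + d) = i + d := by
      simp [revAt, Function.Embedding.coeFn_mk, not_le.mpr hlt]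
    rw [this]
    exact coeff_eq_zero_of_natDegree_lt (lt_of_le_of_lt hq hlt)
  have hqj : ∀ j, 1 ≤ j → q.coeff j = 0 := fun j hj => by
    by_cases hjd : j ≤ d
    · have h1 : q.coeff j = (reflect d q).coeff (d - j) := by
        rw [coeff_reflect, revAt_le (Nat.sub_le d j), Nat.sub_sub_self hjd]
      rw [h1, ← h, coeff_X_pow_mul']
      have : ¬ d ≤ d - j := by omega
      rw [if_neg this]
    · exact coeff_eq_zero_of_natDegree_lt (lt_of_le_of_lt hq (not_le.mp hjd))
  refine ⟨?_, ?_⟩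
  · ext i
    rcases Nat.eq_zero_or_pos i with rfl | hi
    · rw [coeff_C_zero]
    · rw [coeff_C, if_neg (Nat.pos_iff_ne_zero.mp hi), hpi i hi]
  · ext j
    rcases Nat.eq_zero_or_pos j with rfl | hj
    · rw [coeff_C_zero, hp0]
    · rw [coeff_C, if_neg (Nat.pos_iff_ne_zero.mp hj), hqj j hj]

/-- If `X ^ d * p = X * reflect d q` with `natDegree q ≤ d` and `1 ≤ d`, then `p = a + bX` and
`q = b + aX` with `a = q₁`, `b = q₀`. [this work] -/
theorem eq_linear_of_X_pow_mul_eq_X_mul_reflect {p q : κ[X]} {d : ℕ} (hq : q.natDegree ≤ d)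
    (hd : 1 ≤ d) (h : X ^ d * p = X * reflect d q) :
    p = C (q.coeff 1) + C (q.coeff 0) * X ∧ q = C (q.coeff 0) + C (q.coeff 1) * X := by
  -- coefficients of `p`
  have hp : ∀ i, p.coeff i = (X * reflect d q).coeff (i + d) := fun i => by
    rw [← coeff_X_pow_mul p d i, h]
  have hp0 : p.coeff 0 = q.coeff 1 := by
    rw [hp 0, zero_add]
    obtain ⟨d', rfl⟩ : ∃ d', d = d' + 1 := ⟨d - 1, by omega⟩
    rw [coeff_X_mul, coeff_reflect, revAt_le (Nat.le_succ d'), show d'.succ - d' = 1 by omega]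
  have hp1 : p.coeff 1 = q.coeff 0 := by
    rw [hp 1, add_comm, coeff_X_mul, coeff_reflect, revAt_le le_rfl, Nat.sub_self]
  have hpi : ∀ i, 2 ≤ i → p.coeff i = 0 := fun i hi => by
    rw [hp i]
    obtain ⟨i', rfl⟩ : ∃ i', i = i' + 1 := ⟨i - 1, by omega⟩
    rw [show i' + 1 + d = (i' + d) + 1 by ring, coeff_X_mul, coeff_reflect]
    have hlt : d < i' + d := by omega
    have : revAt d (i' + d) = i' + d := by
      simp [revAt, Function.Embedding.coeFn_mk, not_le.mpr hlt]
    rw [this]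
    exact coeff_eq_zero_of_natDegree_lt (lt_of_le_of_lt hq hlt)
  have hqj : ∀ j, 2 ≤ j → q.coeff j = 0 := fun j hj => by
    by_cases hjd : j ≤ d
    · have h1 : q.coeff j = (X * reflect d q).coeff (d - j + 1) := by
        rw [coeff_X_mul, coeff_reflect, revAt_le (Nat.sub_le d j), Nat.sub_sub_self hjd]
      rw [h1, ← h, coeff_X_pow_mul']
      have : ¬ d ≤ d - j + 1 := by omega
      rw [if_neg this]
    · exact coeff_eq_zero_of_natDegree_lt (lt_of_le_of_lt hq (not_le.mp hjd))
  refine ⟨?_, ?_⟩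
  · ext i
    simp only [coeff_add, coeff_C, coeff_C_mul_X]
    rcases Nat.lt_or_ge i 2 with hi | hi
    · interval_cases i
      · simp [hp0]
      · simp [hp1]
    · rw [if_neg (by omega), if_neg (by omega), add_zero, hpi i hi]
  · ext j
    simp only [coeff_add, coeff_C, coeff_C_mul_X]
    rcases Nat.lt_or_ge j 2 with hj | hj
    · interval_cases j
      · simp
      · simp
    · rw [if_neg (by omega), if_neg (by omega), add_zero, hqj j hj]

end Poly

/-! ## §2 One chart: reading modulo `𝔪` through `ε : Γ ⧸ 𝔪Γ ≅ (A/𝔪)[X]` -/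

section OneChart

variable {A : Type*} [CommRing A] {Γ : Type*} [CommRing Γ] [Algebra A Γ]
  (𝔪 : Ideal A) (w : A) (T : Γ)
  (ε : (Γ ⧸ 𝔪.map (algebraMap A Γ)) ≃+* (A ⧸ 𝔪)[X])

/-- `ε` sends the class of `P(T)` to `P̄`. [folklore] -/
theorem chartε_mk_aeval
    (hεC : ∀ a, ε (Ideal.Quotient.mk _ (algebraMap A Γ a)) = C (Ideal.Quotient.mk 𝔪 a))
    (hεX : ε (Ideal.Quotient.mk _ T) = X) (P : A[X]) :
    ε (Ideal.Quotient.mk _ (aeval T P)) = P.map (Ideal.Quotient.mk 𝔪) := by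
  have hcomp : ((ε : _ →+* (A ⧸ 𝔪)[X]).comp (Ideal.Quotient.mk (𝔪.map (algebraMap A Γ)))).comp
      (aeval T : A[X] →ₐ[A] Γ).toRingHom = mapRingHom (Ideal.Quotient.mk 𝔪) := by
    apply Polynomial.ringHom_ext
    · intro a
      simp only [RingHom.comp_apply, AlgHom.toRingHom_eq_coe, AlgHom.coe_toRingHom, aeval_C,
        RingEquiv.coe_toRingHom, coe_mapRingHom, map_C]
      exact hεC a
    · simp only [RingHom.comp_apply, AlgHom.toRingHom_eq_coe, AlgHom.coe_toRingHom, aeval_X,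
        RingEquiv.coe_toRingHom, coe_mapRingHom, map_X]
      exact hεX
  have := congr_arg (fun f : A[X] →+* (A ⧸ 𝔪)[X] => f P) hcomp
  simpa only [RingHom.comp_apply, AlgHom.toRingHom_eq_coe, AlgHom.coe_toRingHom,
    RingEquiv.coe_toRingHom, coe_mapRingHom] using this

/-- `P(T) ∈ 𝔪Γ` iff `P̄ = 0`. [folklore] -/
theorem aeval_mem_map_iff
    (hεC : ∀ a, ε (Ideal.Quotient.mk _ (algebraMap A Γ a)) = C (Ideal.Quotient.mk 𝔪 a))
    (hεX : ε (Ideal.Quotient.mk _ T) = X) (P : A[X]) :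
    aeval T P ∈ 𝔪.map (algebraMap A Γ) ↔ P.map (Ideal.Quotient.mk 𝔪) = 0 := by
  rw [← Ideal.Quotient.eq_zero_iff_mem, ← chartε_mk_aeval 𝔪 T ε hεC hεX P,
    map_eq_zero_iff ε ε.injective]

/-- `a ∈ A` lies in `𝔪Γ` iff `a ∈ 𝔪`. [folklore] -/
theorem algebraMap_mem_map_iff
    (hεC : ∀ a, ε (Ideal.Quotient.mk _ (algebraMap A Γ a)) = C (Ideal.Quotient.mk 𝔪 a))
    (a : A) : algebraMap A Γ a ∈ 𝔪.map (algebraMap A Γ) ↔ a ∈ 𝔪 := by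
  rw [← Ideal.Quotient.eq_zero_iff_mem, ← map_eq_zero_iff ε ε.injective, hεC, C_eq_zero,
    Ideal.Quotient.eq_zero_iff_mem]

/-- On a chart where `𝔪Γ = (w)` with `w ≠ 0` in the domain `Γ` and every element is a
polynomial in `T`: `Tᵉ · c ∈ (wⁿ) ⇒ c ∈ (wⁿ)` (`T̄ = X` is a nonzerodivisor of `(A/𝔪)[X]`).
[folklore] -/
theorem mem_span_pow_of_T_pow_mul_mem [IsDomain Γ]
    (hεC : ∀ a, ε (Ideal.Quotient.mk _ (algebraMap A Γ a)) = C (Ideal.Quotient.mk 𝔪 a))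
    (hεX : ε (Ideal.Quotient.mk _ T) = X)
    (h𝔪w : 𝔪.map (algebraMap A Γ) = Ideal.span {algebraMap A Γ w})
    (hw : algebraMap A Γ w ≠ 0) (hgen : ∀ c : Γ, ∃ P : A[X], c = aeval T P)
    (n e : ℕ) (c : Γ) (h : T ^ e * c ∈ Ideal.span {algebraMap A Γ w ^ n}) :
    c ∈ Ideal.span {algebraMap A Γ w ^ n} := by
  -- the case `n = 1`
  have one : ∀ c : Γ, T ^ e * c ∈ Ideal.span {algebraMap A Γ w} →
      c ∈ Ideal.span {algebraMap A Γ w} := by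
    intro c hc
    obtain ⟨P, rfl⟩ := hgen c
    rw [← h𝔪w] at hc ⊢
    have hc' : aeval T (X ^ e * P) ∈ 𝔪.map (algebraMap A Γ) := by
      rwa [map_mul, map_pow, aeval_X]
    rw [aeval_mem_map_iff 𝔪 T ε hεC hεX] at hc' ⊢
    rw [Polynomial.map_mul, Polynomial.map_pow, map_X] at hc'
    exact (isRegular_X.pow e).left (by simpa only [mul_zero] using hc')
  induction n generalizing c with
  | zero =>
    rw [pow_zero, Ideal.span_singleton_one]
    exact Submodule.mem_top
  | succ n ih =>
    -- `Tᵉ c ∈ (w^{n+1}) ⊆ (w)`, so `c = w c₁`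
    have hc1 : c ∈ Ideal.span {algebraMap A Γ w} := by
      refine one c (Ideal.span_singleton_le_span_singleton.mpr ?_ h)
      exact Dvd.intro_left _ (pow_succ _ n).symm
    obtain ⟨c₁, rfl⟩ := Ideal.mem_span_singleton'.mp hc1
    obtain ⟨d, hd⟩ := Ideal.mem_span_singleton'.mp h
    -- `Tᵉ c₁ w = d w^{n+1}`, cancel `w`
    have hc₁ : T ^ e * c₁ = d * algebraMap A Γ w ^ n := by
      have : (T ^ e * c₁ - d * algebraMap A Γ w ^ n) * algebraMap A Γ w = 0 := by
        rw [sub_mul, mul_assoc, pow_succ] at *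
        rw [← hd]
        ring
      rcases mul_eq_zero.mp this with h0 | h0
      · exact sub_eq_zero.mp h0
      · exact absurd h0 hw
    have := ih c₁ (hc₁ ▸ Ideal.mul_mem_left _ _ (Ideal.subset_span rfl))
    obtain ⟨c₂, rfl⟩ := Ideal.mem_span_singleton'.mp this
    rw [pow_succ]
    exact Ideal.mem_span_singleton'.mpr ⟨c₂, by ring⟩

/-- On a chart as above: `w · (α + β T) ∈ (w²)` iff `α, β ∈ 𝔪`. [folklore] -/
theorem mul_linear_mem_span_sq_iff [IsDomain Γ]
    (hεC : ∀ a, ε (Ideal.Quotient.mk _ (algebraMap A Γ a)) = C (Ideal.Quotient.mk 𝔪 a))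
    (hεX : ε (Ideal.Quotient.mk _ T) = X)
    (h𝔪w : 𝔪.map (algebraMap A Γ) = Ideal.span {algebraMap A Γ w})
    (hw : algebraMap A Γ w ≠ 0) (α β : A) :
    algebraMap A Γ w * (algebraMap A Γ α + algebraMap A Γ β * T) ∈
        Ideal.span {algebraMap A Γ w ^ 2} ↔ α ∈ 𝔪 ∧ β ∈ 𝔪 := by
  have hy : algebraMap A Γ α + algebraMap A Γ β * T = aeval T (C α + C β * X) := by
    simp only [map_add, map_mul, aeval_C, aeval_X]
  constructor
  · intro h
    obtain ⟨d, hd⟩ := Ideal.mem_span_singleton'.mp h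
    have hmem : algebraMap A Γ α + algebraMap A Γ β * T ∈ 𝔪.map (algebraMap A Γ) := by
      rw [h𝔪w]
      refine Ideal.mem_span_singleton'.mpr ⟨d, ?_⟩
      have : (d * algebraMap A Γ w - (algebraMap A Γ α + algebraMap A Γ β * T)) *
          algebraMap A Γ w = 0 := by
        rw [sub_mul, mul_assoc, ← pow_two, hd]; ring
      rcases mul_eq_zero.mp this with h0 | h0
      · exact sub_eq_zero.mp h0
      · exact absurd h0 hw
    rw [hy, aeval_mem_map_iff 𝔪 T ε hεC hεX] at hmem
    have h0 := congr_arg (fun f => coeff f 0) hmem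
    have h1 := congr_arg (fun f => coeff f 1) hmem
    simp only [Polynomial.map_add, Polynomial.map_mul, map_C, map_X, coeff_add, coeff_C_zero,
      coeff_mul_X_zero, add_zero, coeff_zero, coeff_C_succ, coeff_mul_X, zero_add] at h0 h1
    exact ⟨Ideal.Quotient.eq_zero_iff_mem.mp h0, Ideal.Quotient.eq_zero_iff_mem.mp h1⟩
  · rintro ⟨hα, hβ⟩
    have hmem : algebraMap A Γ α + algebraMap A Γ β * T ∈ Ideal.span {algebraMap A Γ w} := by
      rw [← h𝔪w, hy, aeval_mem_map_iff 𝔪 T ε hεC hεX]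
      simp only [Polynomial.map_add, Polynomial.map_mul, map_C, map_X,
        Ideal.Quotient.eq_zero_iff_mem.mpr hα, Ideal.Quotient.eq_zero_iff_mem.mpr hβ, map_zero,
        zero_mul, add_zero]
    obtain ⟨d, hd⟩ := Ideal.mem_span_singleton'.mp hmem
    rw [← hd, pow_two]
    exact Ideal.mem_span_singleton'.mpr ⟨d, by ring⟩

end OneChart

end Summit.ResolutionOfSingularities.ResolutionOfSingularities.Theorems.NoZeno.ExcCount.PointBlowup

end
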